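import Summits.CriticalPhenomena.PercolationContinuityZ3.Theorems.PercNearOneGluingNoHeavyLowerTailKnQuestion8CoefficientwiseCoreClassKernelMixBundleBoundaryIET
import Summits.CriticalPhenomena.PercolationContinuityZ3.Theorems.PercNearOneGluingNoHeavyLowerTailKnQuestion8CoefficientwiseCoreClassKernelMixCycleIET
import HarnessLib

/-!
# IET on Θ(2, m, n): preparation — pendant-edge cluster identities and bookkeeping

Support file (`--supports stmt-CriticalPhenomena-4575`, closed), prover `prim-cplus-coupling` (gen 53).  No definitions, no notations, no named facts,
no sorries; standard axioms.  Memo `prim-cplus-coupling/A5-COUPLING-gen53.md` §1.5.  Companion (the theorem): `…KernelMixShortThread.lean`.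

When a path `u – x – b` of length 2 (edges `f = ux`, `g = xb`, `x` a fresh vertex) is added to a two-terminal graph with edge set `E′`:
* `cluster_insert_hubEdge_u`: `C_u(η + f) = C_u(η) ∪ {x}`;  `cluster_insert_hubEdge_b`: `C_u(η + g) = C_u(η) ∪ {x : b ∈ C_u(η)}` (`η ⊆ E′`);
* `sdiff_insert_insert_*`: the complements `E ∖ ω` for `E = E′ + f + g` and the four positions of `ω` relative to `f, g`;
* `ite_zero_congr`, `arc_edge_inj` (edges of an explicit arc are distinct), and three one-line set identities for `S ∪ {y | y = x ∧ P}`.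
[cite: KozmaNitzan2024, Questions 8–9 (§5.5 p. 36) (context)]
-/

namespace Summit.CriticalPhenomena.PercolationContinuityZ3.Theorems

open Finset Literature.Probability.Percolation

namespace Coefficientwise

variable {ι V : Type*}

open Classical in
/-- **Adding a pendant edge at the root.**  If `ends f = s(u, x)` and no edge of `η` meets `x`, then `C_u(η + f) = C_u(η) ∪ {x}`.
(Closed-set argument.) [folklore] -/
theorem cluster_insert_hubEdge_u (ends : ι → Sym2 V) (η : Finset ι) (f : ι) (u x : V)
    (hf : ends f = s(u, x)) (hx : ∀ i ∈ η, x ∉ ends i) :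
    openCluster (ends '' (↑(insert f η) : Set ι)) u = insert x (openCluster (ends '' (↑η : Set ι)) u) := by
  apply Set.Subset.antisymm
  · refine openCluster_subset_of_closed ends (insert f η) u (S := insert x (openCluster (ends '' (↑η : Set ι)) u))
      (Set.mem_insert_of_mem _ (mem_openCluster_self _ _)) ?_
    intro i hi a c hac haS
    rw [Finset.mem_insert] at hi
    rcases hi with rfl | hi
    · -- the new edge: both ends lie in the set
      rw [hf, Sym2.eq_iff] at hac
      rcases hac with ⟨rfl, rfl⟩ | ⟨rfl, rfl⟩
      · exact Set.mem_insert _ _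
      · exact Set.mem_insert_of_mem _ (mem_openCluster_self _ _)
    · -- an old edge: it avoids x, so its end a is in the old cluster
      rcases haS with rfl | haC
      · exact absurd (by rw [hac]; exact Sym2.mem_mk_left _ _) (hx i hi)
      · exact Set.mem_insert_of_mem _ (mem_openCluster_of_edge ends hi hac haC)
  · intro y hy
    rcases hy with rfl | hy
    · exact mem_openCluster_of_edge ends (Finset.mem_insert_self f η) hf
        (mem_openCluster_self _ _)
    · exact openCluster_image_mono ends (Finset.subset_insert f η) u hy

open Classical in
/-- **Adding a pendant edge at the observer.**  If `ends g = s(x, b)`, `x ≠ u`, `x ≠ b`, and no edge of `η` meets `x`, then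
`C_u(η + g) = C_u(η) ∪ {x : b ∈ C_u(η)}`. (Closed-set argument; a vertex of the cluster other than `u` meets an edge.) [folklore] -/
theorem cluster_insert_hubEdge_b (ends : ι → Sym2 V) (η : Finset ι) (g : ι) (u b x : V)
    (hg : ends g = s(x, b)) (hxu : x ≠ u) (hxb : x ≠ b) (hx : ∀ i ∈ η, x ∉ ends i) :
    openCluster (ends '' (↑(insert g η) : Set ι)) u =
      openCluster (ends '' (↑η : Set ι)) u ∪ {y | y = x ∧ b ∈ openCluster (ends '' (↑η : Set ι)) u} := by
  -- x is not in the old cluster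
  have hxC : x ∉ openCluster (ends '' (↑η : Set ι)) u := by
    intro hxC
    obtain ⟨i, hi, hxi⟩ := exists_edge_of_mem_openCluster ends hxC hxu
    exact hx i hi hxi
  apply Set.Subset.antisymm
  · refine openCluster_subset_of_closed ends (insert g η) u
      (S := openCluster (ends '' (↑η : Set ι)) u ∪ {y | y = x ∧ b ∈ openCluster (ends '' (↑η : Set ι)) u})
      (Set.mem_union_left _ (mem_openCluster_self _ _)) ?_
    intro i hi a c hac haS
    rw [Finset.mem_insert] at hi
    rcases hi with rfl | hi
    · rw [hg, Sym2.eq_iff] at hac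
      rcases hac with ⟨rfl, rfl⟩ | ⟨rfl, rfl⟩
      · -- a = x, c = b
        rcases haS with haC | ⟨_, hbC⟩
        · exact absurd haC hxC
        · exact Set.mem_union_left _ hbC
      · -- a = b, c = x
        rcases haS with hbC | ⟨hbx, _⟩
        · exact Set.mem_union_right _ ⟨rfl, hbC⟩
        · exact absurd hbx.symm hxb
    · rcases haS with haC | ⟨rfl, _⟩
      · exact Set.mem_union_left _ (mem_openCluster_of_edge ends hi hac haC)
      · exact absurd (by rw [hac]; exact Sym2.mem_mk_left _ _) (hx i hi)
  · intro y hy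
    rcases hy with hy | ⟨rfl, hbC⟩
    · exact openCluster_image_mono ends (Finset.subset_insert g η) u hy
    · have hb' : b ∈ openCluster (ends '' (↑(insert g η) : Set ι)) u :=
        openCluster_image_mono ends (Finset.subset_insert g η) u hbC
      exact mem_openCluster_of_edge ends (Finset.mem_insert_self g η) (hg.trans Sym2.eq_swap) hb'


/-- `(if P then a else 0) = (if Q then a′ else 0)` when `P ↔ Q` and `a = a′` under `Q`. [folklore] -/
theorem ite_zero_congr {P Q : Prop} [Decidable P] [Decidable Q] {a a' : ℝ} (hPQ : P ↔ Q) (ha : Q → a = a') :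
    (if P then a else 0) = (if Q then a' else 0) := by
  by_cases hq : Q
  · rw [if_pos (hPQ.mpr hq), if_pos hq, ha hq]
  · rw [if_neg (fun hp => hq (hPQ.mp hp)), if_neg hq]

/-- Edges along an explicit arc are pairwise distinct (from the vertex injectivity). [folklore] -/
theorem arc_edge_inj (ends : ι → Sym2 V) (L : ℕ) (w : ℕ → V) (e : ℕ → ι)
    (harc : ∀ j, 1 ≤ j → j ≤ L → ends (e j) = s(w (j - 1), w j))
    (hwinj : ∀ i j, i ≤ L → j ≤ L → w i = w j → i = j) :
    ∀ s t, 1 ≤ s → s ≤ L → 1 ≤ t → t ≤ L → e s = e t → s = t := by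
  intro s t hs1 hsL ht1 htL hst
  have h1 := harc s hs1 hsL
  have h2 := harc t ht1 htL
  rw [hst] at h1
  have h12 := h1.symm.trans h2
  rw [Sym2.eq_iff] at h12
  rcases h12 with ⟨ha, _⟩ | ⟨ha, hb⟩
  · have := hwinj (s - 1) (t - 1) (by omega) (by omega) ha; omega
  · have := hwinj (s - 1) t (by omega) htL ha
    have := hwinj s (t - 1) hsL (by omega) hb
    omega

/-- Complements in `E = E′ + f + g` (`f ≠ g` fresh): the slice `f ∈ ω, g ∉ ω`. [folklore] -/
theorem sdiff_insert_insert_f [DecidableEq ι] (E E' : Finset ι) (f g : ι) (hE : E = insert f (insert g E')) (hfg : f ≠ g)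
    (hf : f ∉ E') (hg : g ∉ E') (η : Finset ι) (hη : η ⊆ E') : E \ insert f η = insert g (E' \ η) := by
  ext i
  simp only [Finset.mem_sdiff, Finset.mem_insert, hE]
  constructor
  · rintro ⟨h1, h2⟩
    push Not at h2
    rcases h1 with rfl | rfl | h1
    · exact absurd rfl h2.1
    · exact Or.inl rfl
    · exact Or.inr ⟨h1, h2.2⟩
  · rintro (rfl | ⟨h1, h2⟩)
    · refine ⟨Or.inr (Or.inl rfl), ?_⟩
      push Not; exact ⟨fun h' => hfg h'.symm, fun h' => hg (hη h')⟩
    · refine ⟨Or.inr (Or.inr h1), ?_⟩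
      push Not; exact ⟨fun h' => hf (h' ▸ h1), h2⟩

/-- Complements in `E = E′ + f + g`: the slice `g ∈ ω, f ∉ ω`. [folklore] -/
theorem sdiff_insert_insert_g [DecidableEq ι] (E E' : Finset ι) (f g : ι) (hE : E = insert f (insert g E')) (hfg : f ≠ g)
    (hf : f ∉ E') (hg : g ∉ E') (η : Finset ι) (hη : η ⊆ E') : E \ insert g η = insert f (E' \ η) := by
  ext i
  simp only [Finset.mem_sdiff, Finset.mem_insert, hE]
  constructor
  · rintro ⟨h1, h2⟩
    push Not at h2
    rcases h1 with rfl | rfl | h1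
    · exact Or.inl rfl
    · exact absurd rfl h2.1
    · exact Or.inr ⟨h1, h2.2⟩
  · rintro (rfl | ⟨h1, h2⟩)
    · refine ⟨Or.inl rfl, ?_⟩
      push Not; exact ⟨hfg, fun h' => hf (hη h')⟩
    · refine ⟨Or.inr (Or.inr h1), ?_⟩
      push Not; exact ⟨fun h' => hg (h' ▸ h1), h2⟩

/-- Complements in `E = E′ + f + g`: the slice `f, g ∉ ω`. [folklore] -/
theorem sdiff_insert_insert_none [DecidableEq ι] (E E' : Finset ι) (f g : ι) (hE : E = insert f (insert g E'))
    (hf : f ∉ E') (hg : g ∉ E') (η : Finset ι) (hη : η ⊆ E') : E \ η = insert f (insert g (E' \ η)) := by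
  ext i
  simp only [Finset.mem_sdiff, Finset.mem_insert, hE]
  constructor
  · rintro ⟨h1, h2⟩
    rcases h1 with rfl | rfl | h1
    · exact Or.inl rfl
    · exact Or.inr (Or.inl rfl)
    · exact Or.inr (Or.inr ⟨h1, h2⟩)
  · rintro (rfl | rfl | ⟨h1, h2⟩)
    · exact ⟨Or.inl rfl, fun h' => hf (hη h')⟩
    · exact ⟨Or.inr (Or.inl rfl), fun h' => hg (hη h')⟩
    · exact ⟨Or.inr (Or.inr h1), h2⟩

/-- Complements in `E = E′ + f + g`: the slice `f, g ∈ ω`. [folklore] -/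
theorem sdiff_insert_insert_both [DecidableEq ι] (E E' : Finset ι) (f g : ι) (hE : E = insert f (insert g E'))
    (hf : f ∉ E') (hg : g ∉ E') (η : Finset ι) : E \ insert f (insert g η) = E' \ η := by
  ext i
  simp only [Finset.mem_sdiff, Finset.mem_insert, hE]
  constructor
  · rintro ⟨h1, h2⟩
    push Not at h2
    rcases h1 with rfl | rfl | h1
    · exact absurd rfl h2.1
    · exact absurd rfl h2.2.1
    · exact ⟨h1, h2.2.2⟩
  · rintro ⟨h1, h2⟩
    refine ⟨Or.inr (Or.inr h1), ?_⟩
    push Not; exact ⟨fun h' => hf (h' ▸ h1), fun h' => hg (h' ▸ h1), h2⟩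

/-- `E ∖ E′ = {f, g}` when `E = E′ + f + g` with `f, g ∉ E′`. [folklore] -/
theorem sdiff_insert_insert_self [DecidableEq ι] (E E' : Finset ι) (f g : ι) (hE : E = insert f (insert g E'))
    (hf : f ∉ E') (hg : g ∉ E') : E \ E' = insert f (insert g ∅) := by
  ext i
  simp only [Finset.mem_sdiff, Finset.mem_insert, Finset.notMem_empty, or_false, hE]
  constructor
  · rintro ⟨h1, h2⟩
    rcases h1 with h1 | h1 | h1
    · exact Or.inl h1
    · exact Or.inr h1
    · exact absurd h1 h2
  · rintro (rfl | rfl)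
    · exact ⟨Or.inl rfl, hf⟩
    · exact ⟨Or.inr (Or.inl rfl), hg⟩

/-- `b ∈ S ∪ {y | y = x ∧ P} ↔ b ∈ S` for `b ≠ x`. [folklore] -/
theorem mem_union_single_iff {b x : V} (hbx : b ≠ x) (S : Set V) (P : Prop) : b ∈ S ∪ {y | y = x ∧ P} ↔ b ∈ S := by
  constructor
  · rintro (hS | ⟨hbx', _⟩)
    · exact hS
    · exact absurd hbx' hbx
  · exact fun hS => Set.mem_union_left _ hS

/-- `S ∪ {y | y = x ∧ P} = insert x S` when `P` holds. [folklore] -/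
theorem union_single_of_pos (x : V) (S : Set V) (P : Prop) (hP : P) : S ∪ {y | y = x ∧ P} = insert x S := by
  ext y
  simp only [Set.mem_union, Set.mem_setOf_eq, Set.mem_insert_iff]
  tauto

/-- `S ∪ {y | y = x ∧ P} = S` when `P` fails. [folklore] -/
theorem union_single_of_neg (x : V) (S : Set V) (P : Prop) (hP : ¬ P) : S ∪ {y | y = x ∧ P} = S := by
  ext y
  simp only [Set.mem_union, Set.mem_setOf_eq]
  tauto

/-- `b ∈ insert x S ↔ b ∈ S` for `b ≠ x`. [folklore] -/
theorem mem_insert_iff_of_ne {b x : V} (hbx : b ≠ x) (S : Set V) : b ∈ insert x S ↔ b ∈ S := by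
  rw [Set.mem_insert_iff]
  constructor
  · rintro (h' | h'); exact absurd h' hbx; exact h'
  · exact fun h' => Or.inr h'

end Coefficientwise

end Summit.CriticalPhenomena.PercolationContinuityZ3.Theorems
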